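import Literature.MathematicalPhysics.QuantumFieldTheory.Balaban1983to89.B9Thm312WholeRightStepFrom3131
import Literature.MathematicalPhysics.QuantumFieldTheory.Balaban1983to89.B9Thm313WholeDvFromDds

/-!
# `Balaban1983to89.B9Thm33G0DivRFromDir` — [B9] Theorem 3.12 (pp. 421–423), THE DIVERGENCE-LEFT (3.44) MEMBER `D*_U G₀ ∇*_{U,μ}` OF THEOREM 3.3 FOR G₀
# (`Thm33G0DivR.h44Ds`, W-c face `hdiv` of the N06 certificate) IS A THEOREM OF THE DIRECTION-INDEXED (3.44) MEMBERS `∇_{U,ν} G₀ ∇*_{U,μ}` (`Thm33G0Dir.h44m`,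
# DERIVED from rows 19) ONCE THE COVARIANT DIVERGENCE IS READ AS `D*_U = Σ_ν J†_ν ∘ ∇_{U,ν}` — the divergence twin of dag-n06-l's gradient decomposition; schema-GENERIC

T. Bałaban, *Propagators for lattice gauge theories in a background field*, Commun. Math. Phys. **99** (1985) 389–434
[`Balaban1985BackgroundPropagators`, "B9"]; [4] = T. Bałaban, *Propagators and renormalization transformations for lattice gauge
theories. II*, Commun. Math. Phys. **96** (1984) 223–250 [`Balaban1984PropagatorsII`].

statement-level skeleton of published theorems with citation tags; proofs where landed; nothing here is a claim about the Yang–Mills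
mass gap

THE PRINTED LOCI.  [B9] (3.44) p. 398 (the input-Hölder members of Theorem 3.3), p. 398 after (3.47): *"we may always replace ∇_U by ∇*_U, and vice versa,
in arbitrary place and combination"* — on the lattice `∇*_{U,ν} = −𝒯_ν ∘ ∇_{U,ν}` with `𝒯_ν` the transported unit back-shift ((3.5) p. 391 `U(x, x−e_μ) =
U(x−e_μ, x)⁻¹`, (3.8) p. 392), hence the covariant divergence `D*_U A = c_f·Σ_ν ∇*_{U,ν}A_ν` ((3.8); node00-def-Y `OpsYNablaBridge.divY_eq_sum_cdsSL_comp`) is a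
finite sum `Σ_ν J†_ν ∘ ∇_{U,ν}` of the direction derivatives followed by ONE-NEIGHBOUR transported readings `J†_ν` (the transpose twins of dag-n06-l's `J_μ`
of `B9GradViaDivLettersAtPins`, `D_U = Σ_μ ∇*_{U,μ} ∘ J_μ`); [4] (2.51)–(2.56) pp. 232–233 (block majorants compose), Lemma 2.1 (2.61) p. 234 (row sum).

THE POINT (cell `pub-ymgap`, node N06 [B9]; width seat w5, W-c face `hdiv` by dag-lead DEDUP-381; located «∇*-LEFT orbit» by dag-n06-l g16).  The N06 certificate
(ed. 29∕30, `…V6EPairNJ ∕ NK`) displays `hdiv : … → Thm33G0DivR (𝔬12 x) (𝔡A x).Dsd 1 (H x) _ (bHXA x) (bHX x) BiD BdD δ12₀ δ12₃ U`, whose FIRST field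
`h44Ds μ ε : HasMaj (bHX ε) (cNormR … 𝔬.blkW … 0) (𝔬.Dvstar U ∘ₗ (𝔬.G0 U ∘ₗ Dds U μ)) (BiD ε·e^{−δ₀d})` has `D*_U` on the OUTPUT side — so no transport
of the Hölder INPUT is involved (contrast the second field `h44DsDv`, one of dag-n06-l g18's four Hölder-transport members) — while the certificate DERIVES
(from rows 19, `N06G0LayerFromThm310E.g0_layer_of_thm310_coreB`) the direction-indexed members `Thm33G0Dir.h44m (ν, μ) ε : HasMaj (bHX ε) (ofBlocks 𝔬.blk) (Dd U ν ∘ₗ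
(𝔬.G0 U ∘ₗ Dds U μ)) (Bi ε·e^{−δ₀d})` for `0 < ε ≤ 1`.  THIS FILE (schema-generic, the instance letter `J†` is the companion `B9DivViaGradLettersAtPins`):
* §0 private plumbing (`fsum_comp_assoc`); ★ `hasMaj_of_input_dom` (a majorant against a SMALLER input size with the same localisation is a majorant: the
  `∀ ε > 0` of the displayed field vs the `ε ≤ 1` of (3.44), bridged at `min ε 1` by monotonicity of the input family in its exponent);
* §1 ★★ `hasMaj_divLeft_of_family` — for ANY left factor written `Ds = Σ_ν JT ν ∘ₗ Dd ν` with one-neighbour letters `JT ν : ofBlocks blk → cNormR blkW 0`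
  (`C_J·e^{−δ_J d}`) and ANY `T` whose every `Dd ν ∘ₗ T` maps an input size `bin` into `ofBlocks blk` with `Bᵢ·e^{−δ₀d}`: `Ds ∘ₗ T : bin → cNormR blkW 0` with
  `|P|·C_J·Bᵢ·c·e^{−ρd}`, every `0 ≤ ρ ≤ δ₀` with `ρ + σ ≤ δ_J` (the row sum is spent on `J†`, whose rate is free: NO loss on `δ₀` when `δ_J ≥ δ₀ + σ`);
* §2 ★★ `h44Ds_of_h44m` — the displayed field `Thm33G0DivR.h44Ds` for EVERY `ε > 0` from `Thm33G0Dir` + `hDs` + `hJT` + the input monotonicity `hdom`, constant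
  `BiD ε := |P|·(C_J·Bi (min ε 1)·c)`; ★★ `thm33G0DivR_of_dir` — the WHOLE schema `Thm33G0DivR … BiD BdD ρ δ₃ U` with its second field `h44DsDv` taken as a
  HYPOTHESIS verbatim (dag-n06-l g18's member, not restated).
KNIT (dag-n06-d): `hdiv` ⟸ `hG0C`'s `Thm33G0Dir` + the companion's `DvscoKH_eq_sum` (`hDs` after `hDvsco12 ∕ h𝔡Ad`) + `hasMaj_JTcoKH_pins` (`hJT`, δ_J := δ12₀ + σ) +
`bHK` monotonicity in ε + n06-l's `h44DsDv`.

HONEST SCOPE.  Kernel bookkeeping over [4] (2.51)–(2.56)∕(2.61) (`B11SectG.hasMaj_comp_exp`, dag-n06-l's `hasMaj_fsum_const`); `Thm33G0Dir`, the `J†` majorant and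
the input monotonicity are HYPOTHESES here; nothing of [B9]'s propagator estimates asserted; COUNT-NEUTRAL; N06 is NOT discharged; one finite lattice at a time;
nothing continuum, nothing about the mass gap ∕ Clay.  Cell `pub-ymgap` (HUMAN RULING D-0062 ∕ D-0154), Track A node N06 [B9], width seat `pub-ymgap-dag-n06-w5`
(g0′), 2026-08-28.
-/

namespace Literature.MathematicalPhysics.QuantumFieldTheory.Balaban1983to89.B9Thm33G0DivRFromDir

open Literature.MathematicalPhysics.QuantumFieldTheory.Balaban1983to89
open Finset B6RandomWalk B6RandomWalkHom B9Thm34Ext B11SectG B9SectDSup B9Thm312Whole B9Thm312WholeClasses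
open B9RWSums343Holder B9Thm312WholeDir B9Thm312WholeRightStepFrom3131

noncomputable section

variable {g : B9.Geometry} {B : B9.Backgrounds} {X Y Z W PX PY P : Type}
variable [Fintype X] [Fintype Y] [Fintype Z] [Fintype W] [Fintype PX] [Fintype PY] [Fintype P] [Fintype g.Site]
variable {R₀ : ℝ} {H₀ : Prop}

/-! ## §0 Plumbing and the input-size bridge -/

/-- Pre-composition distributes over a finite sum of linear maps, reassociated (private plumbing). [folklore] -/
private theorem fsum_comp_assoc {ι M N K L : Type} [AddCommGroup M] [Module ℝ M] [AddCommGroup N] [Module ℝ N] [AddCommGroup K] [Module ℝ K]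
    [AddCommGroup L] [Module ℝ L] (s : Finset ι) (S : ι → K →ₗ[ℝ] L) (D : ι → N →ₗ[ℝ] K) (T : M →ₗ[ℝ] N) :
    (∑ i ∈ s, S i ∘ₗ D i) ∘ₗ T = ∑ i ∈ s, S i ∘ₗ (D i ∘ₗ T) := by
  apply LinearMap.ext
  intro f
  simp only [LinearMap.comp_apply, LinearMap.sum_apply]

omit [Fintype X] [Fintype Y] [Fintype Z] [Fintype W] [Fintype PX] [Fintype PY] [Fintype P] in
/-- ★ **THE INPUT-SIZE BRIDGE**: a majorant with a non-negative kernel read against an input size `b₁′` that is DOMINATED by `b₁` (same or weaker localisation,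
`b₁′.loc ≤ b₁.loc`) is a majorant against `b₁` — how a (3.44) member at the Hölder exponent `min ε 1` serves every exponent `ε ≥ 1` of a displayed `∀ ε > 0` field
once the input Hölder family grows with its exponent. [cite: Balaban1984PropagatorsII, (2.51) p.232 (bookkeeping); Balaban1985BackgroundPropagators, (3.40) p.397] -/
theorem hasMaj_of_input_dom {F₁ F₂ : Type} [AddCommGroup F₁] [Module ℝ F₁] [AddCommGroup F₂] [Module ℝ F₂]
    {b₁ b₁' : BlockNorm (toB6 g R₀ H₀) F₁} {b₂ : BlockNorm (toB6 g R₀ H₀) F₂} {T : F₁ →ₗ[ℝ] F₂} {K : g.Site → g.Site → ℝ}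
    (hK : ∀ a b, 0 ≤ K a b) (hI : ∀ y μ, b₁.IsLoc y μ → b₁'.IsLoc y μ) (hle : ∀ y μ, b₁'.loc y μ ≤ b₁.loc y μ)
    (h : HasMaj b₁' b₂ T K) : HasMaj b₁ b₂ T K :=
  fun y' μ hμ y => (h y' μ (hI y' μ hμ) y).trans (mul_le_mul_of_nonneg_left (hle y' μ) (hK y y'))

/-! ## §1 A divergence-type left factor after a family of direction members -/

omit [Fintype Y] [Fintype Z] [Fintype PX] [Fintype PY] in
/-- ★★ **A LEFT FACTOR `Ds = Σ_ν J†_ν ∘ ∇_ν` AFTER THE DIRECTION MEMBERS** ([4] (2.52)–(2.56) + (2.61)): if every `∇_ν ∘ T` maps the input size `bin` into the block-sup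
size of `X` with `Bᵢ·e^{−δ₀d}`, and every one-neighbour letter `J†_ν` maps that block-sup size into `𝔠_W⁽⁰⁾` with `C_J·e^{−δ_Jd}`, then `Ds ∘ T = Σ_ν J†_ν ∘ (∇_ν ∘ T)`
maps `bin` into `𝔠_W⁽⁰⁾` with `|P|·C_J·Bᵢ·c·e^{−ρd}` for every `0 ≤ ρ ≤ δ₀` with `ρ + σ ≤ δ_J` — the row sum is donated by the OUTER letter, so `ρ = δ₀` is available
when `δ_J ≥ δ₀ + σ`. [cite: Balaban1985BackgroundPropagators, (3.44) p.398 + p.398 (remark after (3.47)) + (3.8) p.392; Balaban1984PropagatorsII, (2.52)–(2.56) pp.232–233 + Lemma 2.1 (2.61) p.234] -/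
theorem hasMaj_divLeft_of_family (hG : GeoOK g) {σ c : ℝ} (hrow : RowSum (toB6 g R₀ H₀) σ c) (hlen : ∀ y : g.Site, 0 ≤ g.len y)
    {V : Type} [AddCommGroup V] [Module ℝ V] {bin : BlockNorm (toB6 g R₀ H₀) V}
    {blk : X → g.Site} {blkW : W → g.Site} {T : V →ₗ[ℝ] (X → ℝ)} {Dd : P → Module.End ℝ (X → ℝ)}
    {JT : P → (X → ℝ) →ₗ[ℝ] (W → ℝ)} {Ds : (X → ℝ) →ₗ[ℝ] (W → ℝ)} {Bi δ₀ CJ δJ ρ : ℝ}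
    (hBi : 0 ≤ Bi) (hCJ : 0 ≤ CJ) (hρ : 0 ≤ ρ) (hρ0 : ρ ≤ δ₀) (hρJ : ρ + σ ≤ δJ)
    (hDs : Ds = ∑ ν, JT ν ∘ₗ Dd ν)
    (hT : ∀ ν, HasMaj bin (BlockNorm.ofBlocks (toB6 g R₀ H₀) blk) (Dd ν ∘ₗ T) (fun a b => Bi * Real.exp (-(δ₀ * g.dist a b))))
    (hJT : ∀ ν, HasMaj (BlockNorm.ofBlocks (toB6 g R₀ H₀) blk) (cNormR R₀ H₀ blkW hlen 0) (JT ν) (fun a b => CJ * Real.exp (-(δJ * g.dist a b)))) :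
    HasMaj bin (cNormR R₀ H₀ blkW hlen 0) (Ds ∘ₗ T)
      (fun a b => (Fintype.card P : ℝ) * (CJ * Bi * c) * Real.exp (-(ρ * g.dist a b))) := by
  have htri : Triangle254 (toB6 g R₀ H₀) := fun a b c => hG.tri a b c
  -- each `J†_ν ∘ (∇_ν ∘ T)`: the row sum on the outer factor
  have h1 : ∀ ν ∈ (Finset.univ : Finset P), HasMaj bin (cNormR R₀ H₀ blkW hlen 0) (JT ν ∘ₗ (Dd ν ∘ₗ T))
      (fun a b => CJ * Bi * c * Real.exp (-(ρ * g.dist a b))) := by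
    intro ν _
    refine (hasMaj_comp_exp htri hG.dnn hrow hCJ hBi hρ hρ0 hρJ (hJT ν) (hT ν)).mono fun a b => le_of_eq ?_
    show (BlockNorm.ofBlocks (toB6 g R₀ H₀) blk).κ * CJ * Bi * c * Real.exp (-(ρ * (toB6 g R₀ H₀).dist a b)) = _
    have hκ : (BlockNorm.ofBlocks (toB6 g R₀ H₀) blk).κ = 1 := rfl
    rw [hκ, toB6_dist, one_mul]
  rw [hDs, fsum_comp_assoc]
  refine (B9Thm313WholeDvFromDds.hasMaj_fsum_const _ _ _ h1).mono fun a b => le_of_eq ?_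
  rw [Finset.card_univ]
  ring

/-! ## §2 The displayed field `Thm33G0DivR.h44Ds` and the whole schema -/

omit [Fintype Y] [Fintype Z] [Fintype PY] in
/-- ★★ **`Thm33G0DivR.h44Ds` — `D*_U G₀ ∇*_{U,μ}` OUT OF THE INPUT HÖLDER CLASS INTO `𝔠_W⁽⁰⁾`, FOR EVERY `ε > 0` — FROM THEOREM 3.3's DIRECTION MEMBERS (3.44)
`∇_{U,ν} G₀ ∇*_{U,μ}` (`Thm33G0Dir.h44m`, `0 < ε ≤ 1`)**, the divergence decomposition `D*_U = Σ_ν J†_ν ∘ ∇_{U,ν}` (`hDs`), the one-neighbour majorants of the `J†_ν`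
(`hJT`) and the monotonicity of the input family in its exponent (`hdom`, used at `min ε 1`): constant `|P|·(C_J·Bi (min ε 1)·c)`, rate `ρ` (`ρ ≤ δ₀`, `ρ + σ ≤ δ_J`).
[cite: Balaban1985BackgroundPropagators, Thm 3.3 (3.44) p.398 + p.398 (remark after (3.47)) + (3.8) p.392 + Thm 3.12 pp.421–423; Balaban1984PropagatorsII, (2.52)–(2.56) pp.232–233 + Lemma 2.1 (2.61) p.234] -/
theorem h44Ds_of_h44m (hG : GeoOK g) {σ c : ℝ} (hrow : RowSum (toB6 g R₀ H₀) σ c) (hlen : ∀ y : g.Site, 0 ≤ g.len y)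
    {𝔬 : Ops g B X Y Z W} {𝔭 : HolderProbes g B X Y PX PY} {Dd Dds : B.Cfg → P → Module.End ℝ (X → ℝ)}
    {bHX : ℝ → BlockNorm (toB6 g R₀ H₀) (X → ℝ)} {B₀ : ℝ} {Bh Bi : ℝ → ℝ} {Bi2 : ℝ → ℝ → ℝ} {δ₀ : ℝ} {U : B.Cfg}
    {JT : P → (X → ℝ) →ₗ[ℝ] (W → ℝ)} {CJ δJ ρ : ℝ}
    (hBi : ∀ ε, 0 < ε → ε ≤ 1 → 0 ≤ Bi ε) (hCJ : 0 ≤ CJ) (hc : 0 ≤ c) (hρ : 0 ≤ ρ) (hρ0 : ρ ≤ δ₀) (hρJ : ρ + σ ≤ δJ)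
    (hH0 : Thm33G0Dir 𝔬 𝔭 Dd Dds R₀ H₀ bHX B₀ Bh Bi Bi2 δ₀ U)
    (hDs : 𝔬.Dvstar U = ∑ ν, JT ν ∘ₗ Dd U ν)
    (hJT : ∀ ν, HasMaj (BlockNorm.ofBlocks (toB6 g R₀ H₀) 𝔬.blk) (cNormR R₀ H₀ 𝔬.blkW hlen 0) (JT ν)
      (fun a b => CJ * Real.exp (-(δJ * g.dist a b))))
    (hdom : ∀ ε, 1 ≤ ε → (∀ y μ, (bHX ε).IsLoc y μ → (bHX 1).IsLoc y μ) ∧ (∀ y μ, (bHX 1).loc y μ ≤ (bHX ε).loc y μ))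
    (μ : P) (ε : ℝ) (hε : 0 < ε) :
    HasMaj (bHX ε) (cNormR R₀ H₀ 𝔬.blkW hlen 0) (𝔬.Dvstar U ∘ₗ (𝔬.G0 U ∘ₗ Dds U μ))
      (fun a b => (Fintype.card P : ℝ) * (CJ * Bi (min ε 1) * c) * Real.exp (-(ρ * g.dist a b))) := by
  have hm0 : 0 < min ε 1 := lt_min hε one_pos
  have hm1 : min ε 1 ≤ 1 := min_le_right _ _
  -- the members at the exponent `min ε 1`
  have hmem : HasMaj (bHX (min ε 1)) (cNormR R₀ H₀ 𝔬.blkW hlen 0) (𝔬.Dvstar U ∘ₗ (𝔬.G0 U ∘ₗ Dds U μ))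
      (fun a b => (Fintype.card P : ℝ) * (CJ * Bi (min ε 1) * c) * Real.exp (-(ρ * g.dist a b))) :=
    hasMaj_divLeft_of_family hG hrow hlen (hBi _ hm0 hm1) hCJ hρ hρ0 hρJ hDs (fun ν => hH0.h44m (ν, μ) (min ε 1) hm0 hm1) hJT
  by_cases hε1 : ε ≤ 1
  · rw [min_eq_left hε1] at hmem ⊢
    exact hmem
  · have h1ε : 1 ≤ ε := (not_le.mp hε1).le
    rw [min_eq_right h1ε] at hmem ⊢
    have hK : ∀ a b : g.Site, 0 ≤ (Fintype.card P : ℝ) * (CJ * Bi 1 * c) * Real.exp (-(ρ * g.dist a b)) := fun a b =>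
      mul_nonneg (mul_nonneg (Nat.cast_nonneg _) (mul_nonneg (mul_nonneg hCJ (hBi 1 one_pos le_rfl)) hc)) (Real.exp_nonneg _)
    exact hasMaj_of_input_dom hK (hdom ε h1ε).1 (hdom ε h1ε).2 hmem

omit [Fintype Y] [Fintype Z] [Fintype PY] in
/-- ★★ **THE WHOLE SCHEMA `Thm33G0DivR` FROM THEOREM 3.3's DIRECTION MEMBERS AND THE DIVERGENCE DECOMPOSITION** — first field `h44Ds` by `h44Ds_of_h44m` at
`BiD ε := |P|·(C_J·Bi (min ε 1)·c)` and rate `ρ`; the second field `h44DsDv` (`D*_U G₀ D_U` out of the scalar input class — a Hölder-transport member, dag-n06-l g18) is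
taken as a HYPOTHESIS verbatim. [cite: Balaban1985BackgroundPropagators, Thm 3.3 (3.44) p.398 + Thm 3.12 pp.421–423 + p.398 (remark after (3.47)); Balaban1984PropagatorsII, (2.26) p.228, (2.52)–(2.56) pp.232–233] -/
theorem thm33G0DivR_of_dir (hG : GeoOK g) {σ c : ℝ} (hrow : RowSum (toB6 g R₀ H₀) σ c) (hlen : ∀ y : g.Site, 0 ≤ g.len y)
    {𝔬 : Ops g B X Y Z W} {𝔭 : HolderProbes g B X Y PX PY} {Dd Dds : B.Cfg → P → Module.End ℝ (X → ℝ)}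
    {bHX : ℝ → BlockNorm (toB6 g R₀ H₀) (X → ℝ)} {bHW : ℝ → BlockNorm (toB6 g R₀ H₀) (W → ℝ)}
    {B₀ : ℝ} {Bh Bi : ℝ → ℝ} {Bi2 : ℝ → ℝ → ℝ} {δ₀ : ℝ} {U : B.Cfg}
    {JT : P → (X → ℝ) →ₗ[ℝ] (W → ℝ)} {CJ δJ ρ : ℝ} {BiD BdD : ℝ → ℝ} {δ₃ : ℝ}
    (hBi : ∀ ε, 0 < ε → ε ≤ 1 → 0 ≤ Bi ε) (hCJ : 0 ≤ CJ) (hc : 0 ≤ c) (hρ : 0 ≤ ρ) (hρ0 : ρ ≤ δ₀) (hρJ : ρ + σ ≤ δJ)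
    (hBiD : ∀ ε, 0 < ε → (Fintype.card P : ℝ) * (CJ * Bi (min ε 1) * c) ≤ BiD ε)
    (hH0 : Thm33G0Dir 𝔬 𝔭 Dd Dds R₀ H₀ bHX B₀ Bh Bi Bi2 δ₀ U)
    (hDs : 𝔬.Dvstar U = ∑ ν, JT ν ∘ₗ Dd U ν)
    (hJT : ∀ ν, HasMaj (BlockNorm.ofBlocks (toB6 g R₀ H₀) 𝔬.blk) (cNormR R₀ H₀ 𝔬.blkW hlen 0) (JT ν)
      (fun a b => CJ * Real.exp (-(δJ * g.dist a b))))
    (hdom : ∀ ε, 1 ≤ ε → (∀ y μ, (bHX ε).IsLoc y μ → (bHX 1).IsLoc y μ) ∧ (∀ y μ, (bHX 1).loc y μ ≤ (bHX ε).loc y μ))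
    (h44DsDv : ∀ ε : ℝ, 0 < ε → HasMaj (bHW ε) (cNormR R₀ H₀ 𝔬.blkW hlen 0) (𝔬.Dvstar U ∘ₗ (𝔬.G0 U ∘ₗ 𝔬.Dv U))
      (fun a b => BdD ε * Real.exp (-(δ₃ * g.dist a b)))) :
    Thm33G0DivR 𝔬 Dds R₀ H₀ hlen bHX bHW BiD BdD ρ δ₃ U where
  h44Ds μ ε hε := (h44Ds_of_h44m hG hrow hlen hBi hCJ hc hρ hρ0 hρJ hH0 hDs hJT hdom μ ε hε).mono fun _ _ =>
    mul_le_mul_of_nonneg_right (hBiD ε hε) (Real.exp_nonneg _)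
  h44DsDv := h44DsDv

end

end Literature.MathematicalPhysics.QuantumFieldTheory.Balaban1983to89.B9Thm33G0DivRFromDir
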